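import Literature.Analysis.FluidPDE.GavrilovPotential
import HarnessLib

/-!
# Gavrilov's local solution `α(x, y)` of the system (2) near the circle (Lemma 3, Lemma 4, §3)

Topic `Literature/Analysis/FluidPDE`; support file for the discharge of the named fact
`Literature.Analysis.FluidPDE.gavrilov_compact_steady_euler` (Gavrilov 2019, §1 Theorem):
the end of the smooth-category proof of Gavrilov's Lemma 3 and Lemma 4, and the reduction of the
Euler system (3) for the ansatz (4) to identities for `α` (§3), for an abstract profile record
`D : Gavrilov.ProfileData`.

With `x̂` and the potential `Φ` of `GavrilovPotential.lean`, the map `Ξ(F, s) = (x̂, Φ)` has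
`DΞ(0,0) = ¼·id`, hence (inverse function theorem) a local inverse `ξ = (F, s)(x, y)` near
`Ξ(0,0) = (1, 0)`; Gavrilov's solution is `α = â ∘ ξ` (`Gavrilov.ProfileData.alpha`; this is his
"`f(x, α(x,y)) = y²`" solved for `α`, with `f = Φ²`, in a form that needs neither analyticity nor
the even-function lemma).  From `s κ = dâ − F dx̂` one gets `dα = F dx + s dy`
(`hasFDerivAt_alpha`), i.e. the system (2): `∂α/∂x = F(x, α)`, `(∂α/∂y)² = G(x, α)`
(`gF_alpha`, `gG_alpha`), `α(1,0) = 0`, smoothness, the second derivatives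
`α_xx = F_x + F F_α`, `α_xy = α_y F_α`, `α_yy = G_α/2` (`alpha_second_derivs`, via
`DΛ = (Dθ)⁻¹`), whence the two scalar identities to which Gavrilov reduces the Euler equations
(3) for the ansatz (4) in §3 (`alpha_pde1`, `alpha_pde3`), and the strict minimum of Lemma 4
(`alpha_pos`: `α ≥ (F² + s²)/16 > 0` off `(1, 0)`).

## References

* A. V. Gavrilov, *A steady Euler flow with compact support*, Geom. Funct. Anal. 29 (2019)
  190–197, §2.2 Lemma 3, Lemma 4 and Remark 4; §3 (proof of the Lemma after (4)).
  [`Gavrilov2019`]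
-/

noncomputable section

open Set Filter Metric Function
open scoped Topology

namespace Literature.Analysis.FluidPDE

namespace Gavrilov

namespace ProfileData

variable {D : ProfileData}

/-! ### The second chart `Ξ = (x̂, Φ)` and its inverse `ξ` -/

variable (D)

/-- The Jacobian determinant `∂(x̂, Φ)/∂(F, s) = X̂_F Q − P²`. [folklore] -/
def xiDet (n : ℝ × ℝ) : ℝ := (D.lamW (sig n)).1 * D.kQ n - D.kP n * D.kP n

/-- Gavrilov's second change of variables `Ξ(F, s) = (x, y) = (x̂(F, s), Φ(F, s))`.
[cite: Gavrilov2019, §2.2 Lemma 3 (proof: "in the variables `(x, y)` we have `Φ² = y²`")] -/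
def Xi (n : ℝ × ℝ) : ℝ × ℝ := (D.xh n, D.Phi n)

/-- The domain of the second chart: the Poincaré ball, minus the zeros of the Jacobian, inside
`σ⁻¹` of the good ball. [folklore] -/
def xiDom : Set (ℝ × ℝ) :=
  ball ((0 : ℝ), (0 : ℝ)) D.rad0 ∩ {n | D.xiDet n ≠ 0} ∩ sig ⁻¹' ball ((0 : ℝ), (0 : ℝ)) D.rad1

variable {D}

/-- `∂(x̂, Φ)/∂(F, s)(0, 0) = 1/16`. [folklore] -/
@[simp] theorem xiDet_zero : D.xiDet (0, 0) = 1 / 16 := by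
  simp [xiDet]
  norm_num

/-- `Ξ(0, 0) = (1, 0)`. [folklore] -/
@[simp] theorem Xi_zero : D.Xi (0, 0) = (1, 0) := by
  simp [Xi]

/-- `DΞ = [[X̂_F, P], [P, Q]]` on the Poincaré ball. [cite: Gavrilov2019, §2.2 Lemma 3 (proof)] -/
theorem hasFDerivAt_Xi {n : ℝ × ℝ} (hn : n ∈ ball ((0 : ℝ), (0 : ℝ)) D.rad0) :
    HasFDerivAt D.Xi (M (D.lamW (sig n)).1 (D.kP n) (D.kP n) (D.kQ n)) n :=
  (hasFDerivAt_xh (D.ball_rad0_subset hn)).prodMk (hasFDerivAt_Phi hn)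

/-- `Ξ` is smooth on the Poincaré ball. [folklore] -/
theorem contDiffOn_Xi : ContDiffOn ℝ (⊤ : ℕ∞) D.Xi (ball ((0 : ℝ), (0 : ℝ)) D.rad0) :=
  (contDiffOn_xh.mono D.ball_rad0_subset).prodMk contDiffOn_Phi

/-- The Jacobian determinant of `Ξ` is continuous on the Poincaré ball. [folklore] -/
theorem continuousOn_xiDet : ContinuousOn D.xiDet (ball ((0 : ℝ), (0 : ℝ)) D.rad0) :=
  (((contDiffOn_lamW_sig.mono D.ball_rad0_subset).continuousOn.fst).mul
    (contDiffOn_kQ.mono D.ball_rad0_subset).continuousOn).sub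
    ((contDiffOn_kP.mono D.ball_rad0_subset).continuousOn.mul
      (contDiffOn_kP.mono D.ball_rad0_subset).continuousOn)

/-- The domain of the second chart is open. [folklore] -/
theorem isOpen_xiDom : IsOpen D.xiDom :=
  (continuousOn_xiDet.isOpen_inter_preimage isOpen_ball isOpen_compl_singleton).inter
    (isOpen_ball.preimage (contDiff_sig (n := 0)).continuous)

/-- `(0, 0)` lies in the domain of the second chart. [folklore] -/
theorem zero_mem_xiDom : ((0 : ℝ), (0 : ℝ)) ∈ D.xiDom :=
  ⟨⟨mem_ball_self (x := ((0 : ℝ), (0 : ℝ))) D.rad0_pos, by simp⟩,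
    by simpa [sig] using mem_ball_self (x := ((0 : ℝ), (0 : ℝ))) D.rad1_pos⟩

/-- `DΞ` as an invertible matrix on the domain. [folklore] -/
theorem hasFDerivAt_Xi' {n : ℝ × ℝ} (hn : n ∈ D.xiDom) :
    HasFDerivAt D.Xi
      ((ME (D.lamW (sig n)).1 (D.kP n) (D.kP n) (D.kQ n) hn.1.2 : (ℝ × ℝ) ≃L[ℝ] (ℝ × ℝ)) :
        (ℝ × ℝ) →L[ℝ] (ℝ × ℝ)) n := by
  rw [coe_ME]
  exact hasFDerivAt_Xi hn.1.1

/-- `Ξ` is smooth at the points of the domain. [folklore] -/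
theorem contDiffAt_Xi {n : ℝ × ℝ} (hn : n ∈ D.xiDom) : ContDiffAt ℝ (⊤ : ℕ∞) D.Xi n :=
  contDiffOn_Xi.contDiffAt (isOpen_ball.mem_nhds hn.1.1)

variable (D)

/-- **The chart `(F, s) ↦ (x, y)`** as an open partial homeomorphism (inverse function theorem at
the origin, `DΞ(0,0) = ¼·id`). [cite: Gavrilov2019, §2.2 Lemma 3 (proof: implicit function theorem)] -/
def xiPH : OpenPartialHomeomorph (ℝ × ℝ) (ℝ × ℝ) :=
  ((contDiffAt_Xi (D := D) zero_mem_xiDom).toOpenPartialHomeomorph D.Xi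
    (hasFDerivAt_Xi' (D := D) zero_mem_xiDom) (by simp)).restrOpen D.xiDom isOpen_xiDom

/-- The inverse chart `ξ = Ξ⁻¹ : (x, y) ↦ (F, s)`. [cite: Gavrilov2019, §2.2 Lemma 3 (proof)] -/
def xi : ℝ × ℝ → ℝ × ℝ := D.xiPH.symm

/-- The neighbourhood of `(1, 0)` in the `(x, y)`-plane on which the solution lives. [folklore] -/
def locDom : Set (ℝ × ℝ) := D.xiPH.target

/-- **Gavrilov's local solution** `α(x, y) = â(ξ(x, y))` of the system (2).
[cite: Gavrilov2019, §2.2 Lemma 3] -/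
def alpha (q : ℝ × ℝ) : ℝ := D.ah (D.xi q)

/-- `∂α/∂x = F ∘ ξ`. [cite: Gavrilov2019, §2.2 Lemma 3] -/
def alphaX (q : ℝ × ℝ) : ℝ := (D.xi q).1

/-- `∂α/∂y = s ∘ ξ`. [cite: Gavrilov2019, §2.2 Lemma 3] -/
def alphaY (q : ℝ × ℝ) : ℝ := (D.xi q).2

/-- `∂²α/∂x²`. [folklore] -/
def alphaXX (q : ℝ × ℝ) : ℝ := (D.xiDet (D.xi q))⁻¹ * D.kQ (D.xi q)

/-- `∂²α/∂x∂y`. [folklore] -/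
def alphaXY (q : ℝ × ℝ) : ℝ := -((D.xiDet (D.xi q))⁻¹ * D.kP (D.xi q))

/-- `∂²α/∂y²`. [folklore] -/
def alphaYY (q : ℝ × ℝ) : ℝ := (D.xiDet (D.xi q))⁻¹ * (D.lamW (sig (D.xi q))).1

variable {D}

/-- The second chart is `Ξ` as a function. [folklore] -/
@[simp] theorem xiPH_coe : (D.xiPH : ℝ × ℝ → ℝ × ℝ) = D.Xi := rfl

/-- The solution domain is open. [folklore] -/
theorem isOpen_locDom : IsOpen D.locDom := D.xiPH.open_target

/-- `(0, 0)` is in the source of the second chart. [folklore] -/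
theorem zero_mem_xiPH_source : ((0 : ℝ), (0 : ℝ)) ∈ D.xiPH.source :=
  ⟨ContDiffAt.mem_toOpenPartialHomeomorph_source _ _ _, zero_mem_xiDom⟩

/-- `(1, 0)` lies in the solution domain. [folklore] -/
theorem one_zero_mem_locDom : ((1 : ℝ), (0 : ℝ)) ∈ D.locDom := by
  have h := D.xiPH.map_source zero_mem_xiPH_source
  rwa [xiPH_coe, Xi_zero] at h

/-- `ξ(1, 0) = (0, 0)`. [folklore] -/
@[simp] theorem xi_one_zero : D.xi (1, 0) = (0, 0) := by
  have h := D.xiPH.left_inv zero_mem_xiPH_source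
  rwa [xiPH_coe, Xi_zero] at h

/-- `ξ` maps the solution domain into the domain of `Ξ`. [folklore] -/
theorem xi_mem_xiDom {q : ℝ × ℝ} (hq : q ∈ D.locDom) : D.xi q ∈ D.xiDom :=
  (D.xiPH.map_target hq).2

/-- `ξ` maps the solution domain into the `(F, s)`-domain. [folklore] -/
theorem xi_mem_sigDom {q : ℝ × ℝ} (hq : q ∈ D.locDom) : D.xi q ∈ D.sigDom :=
  D.ball_rad0_subset (xi_mem_xiDom hq).1.1

/-- `σ(ξ q)` lies in the good ball. [folklore] -/
theorem sig_xi_mem {q : ℝ × ℝ} (hq : q ∈ D.locDom) :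
    sig (D.xi q) ∈ ball ((0 : ℝ), (0 : ℝ)) D.rad1 :=
  (xi_mem_xiDom hq).2

/-- `Ξ ∘ ξ = id` on the solution domain. [folklore] -/
theorem Xi_xi {q : ℝ × ℝ} (hq : q ∈ D.locDom) : D.Xi (D.xi q) = q := D.xiPH.right_inv hq

/-- `x = x̂(ξ(x, y))`. [folklore] -/
theorem xh_xi {q : ℝ × ℝ} (hq : q ∈ D.locDom) : D.xh (D.xi q) = q.1 := by
  show (D.Xi (D.xi q)).1 = q.1
  rw [Xi_xi hq]

/-- `(x, α(x, y)) = Λ(σ(ξ(x, y)))`. [folklore] -/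
theorem lam_sig_xi {q : ℝ × ℝ} (hq : q ∈ D.locDom) : D.lam (sig (D.xi q)) = (q.1, D.alpha q) :=
  Prod.ext (xh_xi hq) rfl

/-- `(x, α(x, y))` lies in the chart domain (in particular `|α| < 1`). [folklore] -/
theorem fst_alpha_mem_chartDom {q : ℝ × ℝ} (hq : q ∈ D.locDom) : (q.1, D.alpha q) ∈ D.chartDom := by
  rw [← lam_sig_xi hq]
  exact lam_mem_chartDom (xi_mem_sigDom hq)

/-- `|α| < 1` on the solution domain. [folklore] -/
theorem abs_alpha_lt {q : ℝ × ℝ} (hq : q ∈ D.locDom) : |D.alpha q| < 1 :=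
  (fst_alpha_mem_chartDom hq).1

/-- **First equation of (2)**: `∂α/∂x = F(x, α)`. [cite: Gavrilov2019, §2.2 Lemma 3 (system (2))] -/
theorem gF_alpha {q : ℝ × ℝ} (hq : q ∈ D.locDom) : D.gF (q.1, D.alpha q) = D.alphaX q := by
  rw [← lam_sig_xi hq, gF_lam (xi_mem_sigDom hq)]
  rfl

/-- **Second equation of (2)**: `(∂α/∂y)² = G(x, α)`. [cite: Gavrilov2019, §2.2 Lemma 3 (system (2))] -/
theorem gG_alpha {q : ℝ × ℝ} (hq : q ∈ D.locDom) : D.gG (q.1, D.alpha q) = D.alphaY q ^ 2 := by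
  rw [← lam_sig_xi hq, gG_lam (xi_mem_sigDom hq)]
  rfl

/-- `α(1, 0) = 0`. [cite: Gavrilov2019, §2.2 Lemma 3 ("`α(1,0) = 0`")] -/
@[simp] theorem alpha_one_zero : D.alpha (1, 0) = 0 := by
  simp [alpha]

/-- `∂α/∂x (1, 0) = 0`. [folklore] -/
@[simp] theorem alphaX_one_zero : D.alphaX (1, 0) = 0 := by
  simp [alphaX]

/-- `∂α/∂y (1, 0) = 0`. [folklore] -/
@[simp] theorem alphaY_one_zero : D.alphaY (1, 0) = 0 := by
  simp [alphaY]

/-- `Dξ = (DΞ ∘ ξ)⁻¹` on the solution domain. [folklore] -/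
theorem hasFDerivAt_xi {q : ℝ × ℝ} (hq : q ∈ D.locDom) :
    HasFDerivAt D.xi
      (((ME (D.lamW (sig (D.xi q))).1 (D.kP (D.xi q)) (D.kP (D.xi q)) (D.kQ (D.xi q))
        (xi_mem_xiDom hq).1.2).symm : (ℝ × ℝ) ≃L[ℝ] (ℝ × ℝ)) : (ℝ × ℝ) →L[ℝ] (ℝ × ℝ)) q :=
  D.xiPH.hasFDerivAt_symm hq (hasFDerivAt_Xi' (xi_mem_xiDom hq))

/-- `ξ` is smooth at the points of the solution domain. [folklore] -/
theorem contDiffAt_xi {q : ℝ × ℝ} (hq : q ∈ D.locDom) : ContDiffAt ℝ (⊤ : ℕ∞) D.xi q :=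
  D.xiPH.contDiffAt_symm hq (hasFDerivAt_Xi' (xi_mem_xiDom hq)) (contDiffAt_Xi (xi_mem_xiDom hq))

/-- `ξ` is smooth on the solution domain. [folklore] -/
theorem contDiffOn_xi : ContDiffOn ℝ (⊤ : ℕ∞) D.xi D.locDom := fun _ hq =>
  (contDiffAt_xi hq).contDiffWithinAt

/-- `α` is smooth on the solution domain. [cite: Gavrilov2019, §2.2 Lemma 3] -/
theorem contDiffOn_alpha : ContDiffOn ℝ (⊤ : ℕ∞) D.alpha D.locDom :=
  contDiffOn_ah.comp contDiffOn_xi fun _ hq => xi_mem_sigDom hq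

/-- `∂α/∂x` is smooth on the solution domain. [folklore] -/
theorem contDiffOn_alphaX : ContDiffOn ℝ (⊤ : ℕ∞) D.alphaX D.locDom := contDiffOn_xi.fst

/-- `∂α/∂y` is smooth on the solution domain. [folklore] -/
theorem contDiffOn_alphaY : ContDiffOn ℝ (⊤ : ℕ∞) D.alphaY D.locDom := contDiffOn_xi.snd

/-- **`dα = F dx + s dy`**: the derivative of the solution. [cite: Gavrilov2019, §2.2 Lemma 3 (proof: "`(dα − F dx)² − G dy² = 0`")] -/
theorem hasFDerivAt_alpha {q : ℝ × ℝ} (hq : q ∈ D.locDom) :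
    HasFDerivAt D.alpha (L (D.alphaX q) (D.alphaY q)) q := by
  have hm := xi_mem_sigDom hq
  have h := (hasFDerivAt_ah hm).comp q (hasFDerivAt_xi hq)
  refine h.congr_fderiv ?_
  have hfd : L (D.lamW (sig (D.xi q))).2 (2 * (D.xi q).2 * (D.lamZ (sig (D.xi q))).2) =
      (D.xi q).2 • D.kappa (D.xi q) + (D.xi q).1 • fderiv ℝ D.xh (D.xi q) := by
    rw [← (hasFDerivAt_ah hm).fderiv, smul_kappa hm]
    abel
  rw [hfd, (hasFDerivAt_xh hm).fderiv, kappa]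
  have hdet : (D.lamW (sig (D.xi q))).1 * D.kQ (D.xi q) - D.kP (D.xi q) * D.kP (D.xi q) ≠ 0 :=
    (xi_mem_xiDom hq).1.2
  have hinv : ((D.lamW (sig (D.xi q))).1 * D.kQ (D.xi q) - D.kP (D.xi q) * D.kP (D.xi q))⁻¹ *
      ((D.lamW (sig (D.xi q))).1 * D.kQ (D.xi q) - D.kP (D.xi q) * D.kP (D.xi q)) = 1 :=
    inv_mul_cancel₀ hdet
  apply ContinuousLinearMap.ext
  intro v
  simp only [ContinuousLinearMap.coe_comp, comp_apply, _root_.add_apply, _root_.FunLike.coe_smul,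
    Pi.smul_apply, smul_eq_mul, L_apply, alphaX, alphaY, ContinuousLinearEquiv.coe_coe,
    ME_symm_apply]
  linear_combination ((D.xi q).1 * v.1 + (D.xi q).2 * v.2) * hinv

/-- The second derivatives: `d(∂α/∂x) = α_xx dx + α_xy dy`. [folklore] -/
theorem hasFDerivAt_alphaX {q : ℝ × ℝ} (hq : q ∈ D.locDom) :
    HasFDerivAt D.alphaX (L (D.alphaXX q) (D.alphaXY q)) q := by
  have h := hasFDerivAt_fst.comp q (hasFDerivAt_xi hq)
  refine h.congr_fderiv ?_
  rw [eq_L ((ContinuousLinearMap.fst ℝ ℝ ℝ).comp _)]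
  simp [alphaXX, alphaXY, xiDet]

/-- The second derivatives: `d(∂α/∂y) = α_xy dx + α_yy dy`. [folklore] -/
theorem hasFDerivAt_alphaY {q : ℝ × ℝ} (hq : q ∈ D.locDom) :
    HasFDerivAt D.alphaY (L (D.alphaXY q) (D.alphaYY q)) q := by
  have h := hasFDerivAt_snd.comp q (hasFDerivAt_xi hq)
  refine h.congr_fderiv ?_
  rw [eq_L ((ContinuousLinearMap.snd ℝ ℝ ℝ).comp _)]
  simp [alphaXY, alphaYY, xiDet]

/-! ### The second derivatives in terms of `F`, `G` and the two equations of §3 -/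

/-- Identification of the second derivatives: `α_xx = F_x + F F_α`, `α_xy = α_y F_α`,
`α_yy = G_α / 2` at `(x, α(x, y))`. [cite: Gavrilov2019, §2.2 Lemma 4 (proof) and §3] -/
theorem alpha_second_derivs {q : ℝ × ℝ} (hq : q ∈ D.locDom) :
    D.alphaXX q = D.gFx (q.1, D.alpha q) + D.gF (q.1, D.alpha q) * D.gFa (q.1, D.alpha q) ∧
    D.alphaXY q = D.alphaY q * D.gFa (q.1, D.alpha q) ∧
    D.alphaYY q = D.gGa (q.1, D.alpha q) / 2 := by
  have hm := xi_mem_sigDom hq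
  have hn : sig (D.xi q) ∈ D.thetaPH.target := sig_mem_of_mem_sigDom hm
  obtain ⟨h1, h2⟩ := thetaJ_lamW hn
  obtain ⟨h3, h4⟩ := thetaJ_lamZ hn
  have hT := chart_transport hn
  have hD := thetaDet_mul_lamDet hn
  have hdet : D.xiDet (D.xi q) ≠ 0 := (xi_mem_xiDom hq).1.2
  rw [lam_sig_xi hq] at h1 h2 h3 h4 hD
  rw [gF_alpha hq]
  simp only [sig, thetaDet, alphaXX, alphaXY, alphaYY, alphaX, alphaY, xiDet, kP, kQ] at *
  -- abbreviations
  set F := (D.xi q).1 with hF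
  set s := (D.xi q).2 with hs
  set w1 := (D.lamW (F, s ^ 2)).1 with hw1
  set w2 := (D.lamW (F, s ^ 2)).2 with hw2
  set z1 := (D.lamZ (F, s ^ 2)).1 with hz1
  set z2 := (D.lamZ (F, s ^ 2)).2 with hz2
  set a' := D.gFx (q.1, D.alpha q) with ha'
  set b' := D.gFa (q.1, D.alpha q) with hb'
  set c' := D.gGx (q.1, D.alpha q) with hc'
  set d' := D.gGa (q.1, D.alpha q) with hd'
  -- `Δ = 2 det DΛ` and `det Dθ · Δ = 2`
  have hΔ : w1 * (2 * (z2 - F * z1)) - 2 * s * z1 * (2 * s * z1) = 2 * (w1 * z2 - z1 * w2) := by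
    linear_combination (2 * z1) * hT
  have hΔ2 : (a' * d' - b' * c') * (w1 * (2 * (z2 - F * z1)) - 2 * s * z1 * (2 * s * z1)) = 2 := by
    rw [hΔ]
    linear_combination 2 * hD
  have hinv : (w1 * (2 * (z2 - F * z1)) - 2 * s * z1 * (2 * s * z1))⁻¹ = (a' * d' - b' * c') / 2 := by
    have h2' : (w1 * (2 * (z2 - F * z1)) - 2 * s * z1 * (2 * s * z1)) * ((a' * d' - b' * c') / 2) = 1 := by
      linear_combination (1 / 2 : ℝ) * hΔ2
    exact inv_eq_of_mul_eq_one_right h2'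
  rw [hinv]
  refine ⟨?_, ?_, ?_⟩
  · linear_combination a' * h4 - c' * h3 - F * (d' * h3 - b' * h4)
  · linear_combination (-s) * (d' * h3 - b' * h4)
  · linear_combination (1 / 2 : ℝ) * (d' * h1 - b' * h2)

/-- **Gavrilov §3, the `e_z`-equation of (3)** for the ansatz (4), reduced to `α`:
`x α_x α_xy + α_y (α_x + 4x³ − x α_xx) = 0` — a consequence of (2) and (2b).
[cite: Gavrilov2019, §3 (proof of the Lemma: "The last one is equivalent to …")] -/
theorem alpha_pde3 {q : ℝ × ℝ} (hq : q ∈ D.locDom) :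
    q.1 * D.alphaX q * D.alphaXY q +
      D.alphaY q * (D.alphaX q + 4 * q.1 ^ 3 - q.1 * D.alphaXX q) = 0 := by
  obtain ⟨hxx, hxy, -⟩ := alpha_second_derivs hq
  have h2b := gavrilov_2b (D := D) (q.1, D.alpha q)
  rw [gF_alpha hq] at h2b hxx
  rw [hxx, hxy]
  linear_combination (-D.alphaY q) * h2b

/-- **Gavrilov §3, the `e_ρ`-equation of (3)** for the ansatz (4), reduced to `α`:
`x α_x α_yy − x α_y α_xy + α_y² − 4x³ α_x + H(α) = 0` — a consequence of (2), (2a) and (2b).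
[cite: Gavrilov2019, §3 (proof of the Lemma: "Finally, the first equation is …")] -/
theorem alpha_pde1 {q : ℝ × ℝ} (hq : q ∈ D.locDom) :
    q.1 * D.alphaX q * D.alphaYY q - q.1 * D.alphaY q * D.alphaXY q + D.alphaY q ^ 2 -
      4 * q.1 ^ 3 * D.alphaX q + D.H (D.alpha q) = 0 := by
  obtain ⟨-, hxy, hyy⟩ := alpha_second_derivs hq
  have h2a := gavrilov_2a (D := D) (fst_alpha_mem_chartDom hq).1
  have h2b := gavrilov_2b (D := D) (q.1, D.alpha q)
  have hG := gG_alpha hq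
  have hGdef : D.gG (q.1, D.alpha q) =
      12 * q.1 ^ 2 * D.alpha q - D.gF (q.1, D.alpha q) ^ 2 - D.H (D.alpha q) := rfl
  have hGxdef : D.gGx (q.1, D.alpha q) =
      24 * q.1 * D.alpha q - 2 * D.gF (q.1, D.alpha q) * D.gFx (q.1, D.alpha q) := rfl
  rw [gF_alpha hq] at h2a h2b hGdef hGxdef
  rw [hyy, hxy]
  linear_combination (q.1 * D.gFa (q.1, D.alpha q) - 1) * hG + (q.1 / 2) * h2a + hGdef +
    (-(q.1 / 2)) * hGxdef + D.alphaX q * h2b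

/-- **Lemma 4 (strict minimum)**: `α > 0` on the solution domain off the point `(1, 0)`
(quantitatively `α ≥ (F² + s²)/16` in the chart `ξ = (F, s)`). [cite: Gavrilov2019, §2.2 Lemma 4] -/
theorem alpha_pos {q : ℝ × ℝ} (hq : q ∈ D.locDom) (hq1 : q ≠ (1, 0)) : 0 < D.alpha q := by
  have hm0 : D.xi q ≠ (0, 0) := fun h => hq1 (by rw [← Xi_xi hq, h, Xi_zero])
  have hlow := ah_lower (sig_xi_mem hq) (by simp only [sig]; positivity)
  have hα : D.alpha q = (D.lam (sig (D.xi q))).2 := rfl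
  rw [hα]
  refine lt_of_lt_of_le ?_ hlow
  simp only [sig]
  have hne : (D.xi q).1 ≠ 0 ∨ (D.xi q).2 ≠ 0 :=
    not_and_or.1 fun h => hm0 (Prod.ext h.1 h.2)
  rcases hne with h | h
  · nlinarith [mul_self_pos.2 h, sq_nonneg (D.xi q).2]
  · nlinarith [mul_self_pos.2 h, sq_nonneg (D.xi q).1]

/-- `α` is continuous on the solution domain. [folklore] -/
theorem continuousOn_alpha : ContinuousOn D.alpha D.locDom := contDiffOn_alpha.continuousOn

end ProfileData

end Gavrilov

end Literature.Analysis.FluidPDE
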